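import Summits.BirchSwinnertonDyer.BirchSwinnertonDyer.Theorems.ByReductionTypeAtTwoSupersingularFlatPairFunInjective
import Summits.BirchSwinnertonDyer.BirchSwinnertonDyer.Theorems.ByReductionTypeAtTwoSupersingularFlatZetaBridge
import Summits.BirchSwinnertonDyer.BirchSwinnertonDyer.Theorems.ByReductionTypeAtTwoSupersingularFlatZetaPackage
import HarnessLib

/-!
# Route `ByReductionTypeAtTwo` (rung K4), crux `SupersingularRankZeroAtTwo` (item stmt-BirchSwinnertonDyer-19097), line
# `odd_blind_package` v2.19, stub 3/5 `stub_flatPackage`, conjunct (8) — **FILE Z6 of hand hF3-ZETA: THE ASSEMBLY** — from the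
# LEVELWISE CONGRUENCES of a coprime family of genuine classes (tower-1's E3 for Kato's lifts, per cusp datum `δ`) STRAIGHT TO
# F3a ∧ F3b ∧ ZL2 of conjunct (8), composing Z1 (injectivity) · Z2 (proportionality) · Z3 (generator) · Z4 (division) · Z5 (package)
# — the zeta LINE `Λ∙s₀ ⊂ 𝐇¹_Γ(T₂W)` with `C d·Col♭(pairFun s₀) = L♭` ON THE NOSE (cell `bsd-2adic`, seat `bsd-2adic-t42` GEN 51;
# `--supports 19097`, helper)

HONEST FRAMING (D-0054): THEOREMS ONLY — no definition, no named fact, no instance, no `sorry`.  CONSUMER: every analytic input is a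
DISPLAYED hypothesis — the levelwise congruences `hE3` (explicit reciprocity at `2`, tower-1 hand hF3-ERL), the coprimality of the cusp
multipliers at the height-one primes `∌ 2` WITH genuineness of the classes (K3's cusp brick + `Kato2004.isEulerSystemClassTwo_of_zetaBody` +
kernel Rohrlich), the coprimality AT `(2)` (`h2`, (B1)), the `2`-integrality `t = ϖ·d ∈ ℤ₂` ((B1)), the rank clause of Kato 12.4 (2)
(`hrank`, `stub_pub`) and `L♭ ≠ 0` (`SSFlatRoad.flat_ne_zero_two` on the habitat).  Helper toward conjunct (8); closes NO stub; 19097 stays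
OPEN on its 5 registered stubs; nothing booked; BSD₂ is proved for no supersingular curve and BSD for no curve by any of this; typed ≠ proved.

## The assembly (Kato §13.9–13.14 AT `p = 2`, with Sprung's ♭ Coleman map in place of Perrin-Riou's)

Data: the crux binders (habitat `GoodSS W 2`, cyclotomic `(κ, γ)`, `v`, a Honda system AT TWO `(g, cneg, c)` for `a₂`), the pin `I`, the
`Λ`-linear `pairFun` `L` and Coleman map `J`, any `P`/`loc` with `(loc x : Λ) = Col♭(L x)`, the Sprung pair `(L♯, L♭)` of `f`, `ϖ`; and a
family of classes `x_δ ∈ 𝐇¹` with multipliers `A_δ ∈ Λ` and a common `d ∈ ℤ₂ ∖ 0` such that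
(H-LEV) `∀ δ n, ∃ m q, 2^m·(ι(A_δ)·θ̃_n − ι(C d·P_{n,c_n}(L x_δ))) = ι(ω_n q)`,
(COP) every height-one `𝔭 ∌ 2` misses some `A_δ` whose `x_δ` is a non-zero genuine Euler class, (h2) every height-one `𝔭 ∋ 2` misses some `A_δ`,
(INT) `t = ϖ·d ∈ ℤ₂`.  Steps (`flatF3_package_of_levelCongruences`):
1. CHROMATIC CANCELLATION (Z2): `A_{δ'} • J(L x_δ) = A_δ • J(L x_{δ'})` in `Λ²`.
2. GENERATOR IN `Λ²` (Z3 on the free module `Λ²`): `σ₀` with `A_δ • σ₀ = J(L x_δ)`.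
3. DIVISION (Z4 `thetaCongruence_of_family`, with `P₀ := −(u_n σ₀.1 + v_n σ₀.2)`): `(C d·σ₀.1, C d·σ₀.2)` is a SPRUNG PAIR of `f`, hence `= (L♯, L♭)`
   (`Sprung2017.IsSprungPair.unique`); so `σ₀.2 ≠ 0` and `Col♭(L x_{δ₀}) = A_{δ₀}·σ₀.2 ≠ 0`.
4. INJECTIVITY (Z1, `rank 𝐇¹ ≤ 1`): `loc♭ = Col♭ ∘ L` is injective on `𝐇¹`; PROPORTIONALITY IN `𝐇¹` (Z2): `A_{δ'} • x_δ = A_δ • x_{δ'}`.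
5. GENERATOR IN `𝐇¹` (Z3, freeness on the habitat): `s₀ ∈ 𝐇¹`, `A_δ • s₀ = x_δ`, with the ZL2 clause; `J(L s₀) = σ₀`, so `C d·Col♭(L s₀) = L♭`.
6. PACKAGE (Z5 `flatF3_package_of_mul_coleman_eq`): `Z := Λ∙s₀`, `G := Col♭(L (C t • s₀))`, F3a ∧ F3b ∧ ZL2 VERBATIM.

References: [Kato2004Asterisque] K. Kato, Astérisque 295 (2004), Thm. 12.4 (2)(3), Thm. 12.5 (1)(4), Thm. 12.6 (pp. 221–222), §13.9 (p. 230),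
§13.12–13.14 (pp. 231–234), Thm. 16.6; [Sprung2012] Def. 5.9, Def. 7.1, Thm. 7.14, 7.16; [Sprung2017] Thm. 1.12, Cor. 4.4–4.5; [Kobayashi2003] Thm. 6.3.
-/

set_option autoImplicit false
-- the Theorems namespace of this sub repeats the summit name by design (D-0017 nested layout)
set_option linter.dupNamespace false

noncomputable section

open scoped Classical NumberField

open Polynomial

namespace Summit.BirchSwinnertonDyer.BirchSwinnertonDyer.Theorems

namespace SSFlatPackage

open NumberField IsDedekindDomain WeierstrassCurve Literature.NumberTheory.EllipticCurves
  Literature.NumberTheory.EllipticCurves.ZpExtension Literature.NumberTheory.EllipticCurves.Sprung2017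
  Literature.NumberTheory.EllipticCurves.Kobayashi2003 Literature.NumberTheory.EllipticCurves.Sprung2012
  Literature.NumberTheory.EllipticCurves.Rank1Residual Literature.NumberTheory.GaloisRepresentations CongruenceSubgroup

/-! ## §1 The Sprung pair of a coprime family (steps 1–3; `p`-generic) -/

section SprungPair

universe u

variable {K : Type u} [Field K] {p : ℕ} [hp : Fact p.Prime] {κ : ZpExtension K p}
variable {E : Type u} [Field E] [Algebra K E] {ι' : AlgebraicClosure K →ₐ[K] AlgebraicClosure E}
variable {W : WeierstrassCurve K}

/-- A coprime family has a member with non-zero multiplier (take the height-one prime `(T) ∌ p`). [folklore] -/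
theorem exists_ne_zero_of_coprime {ι : Type*} (A : ι → IwasawaAlgebra p)
    (hcop : ∀ 𝔭 : PrimeSpectrum (IwasawaAlgebra p), 𝔭.asIdeal.height = 1 →
      PowerSeries.C (p : ℤ_[p]) ∉ 𝔭.asIdeal → ∃ i, A i ∉ 𝔭.asIdeal) :
    ∃ i, A i ≠ 0 := by
  obtain ⟨i, hi⟩ := forall_prime_exists_not_dvd_of_forall_heightOne_not_mem A _ hcop PowerSeries.X PowerSeries.X_prime
    not_X_dvd_C
  exact ⟨i, fun h ↦ hi (h ▸ dvd_zero _)⟩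

/-- ★ **THE SPRUNG PAIR OF A COPRIME FAMILY (steps 1–3 of the assembly).**  For the data `(a_p, g, c)` (`p ∣ a_p`, levels, traces), a
`Λ`-linear `L : H → H¹_Iw` and a `Λ`-linear Coleman map `J`, a family `x_δ ∈ H` with multipliers `A_δ` coprime at the height-one primes
`∌ p`, `d ∈ ℤ_p ∖ 0`, and the levelwise congruences (H-LEV) against `θ̃_n = (mazurTateElement f p n)^{ℚ_p}`: there is `σ₀ ∈ Λ²` with
`A_δ • σ₀ = J (L x_δ)` for every `δ`, and `(C d·σ₀.1, C d·σ₀.2)` IS A SPRUNG PAIR of `f` at `p` (`Sprung2017.IsSprungPair`) — so it equals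
`(L♯, L♭)` by `IsSprungPair.unique`.  Chromatic cancellation (Z2) + generator in the free module `Λ²` (Z3) + division (Z4).
[cite: Kato2004Asterisque, Thm. 12.5 (1) (p. 222), §13.9 (p. 230)] [cite: Sprung2017, Thm. 1.12, Cor. 4.4–4.5] [cite: Sprung2012, Def. 5.9 (p. 1495)] -/
theorem exists_smul_eq_coleman_and_isSprungPair_of_family {g : Field.absoluteGaloisGroup E}
    (hg : κ.IsTopGenerator (resGalOfEmb ι' g)) {ap : ℤ} (hap : (p : ℤ) ∣ ap) {c : ℕ → localPoints W E}
    {H : Type*} [AddCommGroup H] [Module (IwasawaAlgebra p) H]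
    (L : letI := moduleOfGenerator κ ι' W hg; H →ₗ[IwasawaAlgebra p] (localTowerPointsOfEmb κ ι' W →+ ℤ_[p]))
    (J : letI := moduleOfGenerator κ ι' W hg
      (localTowerPointsOfEmb κ ι' W →+ ℤ_[p]) →ₗ[IwasawaAlgebra p] IwasawaAlgebra p × IwasawaAlgebra p)
    (hJ : ∀ w, IsColemanPair κ ι' W ap g c w (J w).1 (J w).2)
    {ι : Type*} (x : ι → H) (A : ι → IwasawaAlgebra p) {d : ℤ_[p]} (hd : d ≠ 0)
    (hcop : ∀ 𝔭 : PrimeSpectrum (IwasawaAlgebra p), 𝔭.asIdeal.height = 1 →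
      PowerSeries.C (p : ℤ_[p]) ∉ 𝔭.asIdeal → ∃ i, A i ∉ 𝔭.asIdeal)
    (hcop2 : ∀ 𝔭 : PrimeSpectrum (IwasawaAlgebra p), 𝔭.asIdeal.height = 1 →
      PowerSeries.C (p : ℤ_[p]) ∈ 𝔭.asIdeal → ∃ i, A i ∉ 𝔭.asIdeal)
    {N : ℕ} (f : CuspForm (Gamma0 N) 2)
    (hE3 : ∀ (i : ι) (n : ℕ), ∃ (m : ℕ) (q : IwasawaAlgebra p), PowerSeries.C ((p : ℚ_[p]) ^ m) *
        (iwasawaToPowerSeries p (A i) * (((mazurTateElement f p n).map (algebraMap ℚ ℚ_[p]) : ℚ_[p][X]) : PowerSeries ℚ_[p]) -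
          iwasawaToPowerSeries p (PowerSeries.C d * pairingSum W (localTowerPointsOfEmb κ ι' W) g n (c n) (L (x i)))) =
      iwasawaToPowerSeries p ((((cyclotomicOmega p n).map (Int.castRingHom ℤ_[p]) : ℤ_[p][X]) : PowerSeries ℤ_[p]) * q)) :
    ∃ σ₀ : IwasawaAlgebra p × IwasawaAlgebra p, (∀ i, A i • σ₀ = J (L (x i))) ∧
      IsSprungPair f p ap (PowerSeries.C d * σ₀.1) (PowerSeries.C d * σ₀.2) := by
  letI := moduleOfGenerator κ ι' W hg
  -- every height-one prime misses some `A_δ`; some `A_{δ₀} ≠ 0`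
  have hcopAll : ∀ 𝔭 : PrimeSpectrum (IwasawaAlgebra p), 𝔭.asIdeal.height = 1 → ∃ i, A i ∉ 𝔭.asIdeal := by
    intro 𝔭 h𝔭
    by_cases hmem : PowerSeries.C (p : ℤ_[p]) ∈ 𝔭.asIdeal
    · exact hcop2 𝔭 h𝔭 hmem
    · exact hcop 𝔭 h𝔭 hmem
  obtain ⟨i₀, hA0⟩ := exists_ne_zero_of_coprime A hcop
  -- step 1: proportionality of the Coleman values
  have hprop : ∀ i j, A j • J (L (x i)) = A i • J (L (x j)) := by
    intro i j
    obtain ⟨hS, hF⟩ := smul_coleman_eq_of_levelCongruences hap (hJ (L (x i))) (hJ (L (x j))) (A i) (A j) fun n ↦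
      exists_omega_dvd_C_pow_mul_sub_of_thetaCongruences _ hd (hE3 i n) (hE3 j n)
    exact Prod.ext (by simpa [smul_eq_mul] using hS) (by simpa [smul_eq_mul] using hF)
  -- step 2: the generator in the free module `Λ²`
  obtain ⟨σ₀, hσ₀⟩ := exists_generator_of_coprime_family (fun i ↦ J (L (x i))) A i₀ hA0 hprop
    (forall_prime_exists_not_dvd_of_forall_heightOne A hcopAll)
  refine ⟨σ₀, hσ₀, fun n ↦ ?_⟩
  -- step 3: division — `(C d·σ₀)` satisfies the Mazur–Tate congruence at level `n`
  obtain ⟨a, Θ₀, hΘ⟩ := exists_C_pow_mul_coe_eq_iwasawaToPowerSeries (p := p) ((mazurTateElement f p n).map (algebraMap ℚ ℚ_[p]))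
  set P₀ : IwasawaAlgebra p := -(toIwasawa p (sharpPoly ap p n) * σ₀.1 + toIwasawa p (flatPoly ap p n) * σ₀.2) with hP₀
  have hP : ∀ i, toIwasawa p (cyclotomicOmega p n) ∣
      pairingSum W (localTowerPointsOfEmb κ ι' W) g n (c n) (L (x i)) - A i * P₀ := by
    intro i
    have h := hJ (L (x i)) n
    rw [← hσ₀ i, Prod.smul_fst, Prod.smul_snd, smul_eq_mul, smul_eq_mul] at h
    have e : pairingSum W (localTowerPointsOfEmb κ ι' W) g n (c n) (L (x i)) - A i * P₀ =
        pairingSum W (localTowerPointsOfEmb κ ι' W) g n (c n) (L (x i)) +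
          (toIwasawa p (sharpPoly ap p n) * (A i * σ₀.1) + toIwasawa p (flatPoly ap p n) * (A i * σ₀.2)) := by
      rw [hP₀]; ring
    rw [e]
    exact h
  obtain ⟨m, q, e⟩ := thetaCongruence_of_family A hcop n _ hΘ (PowerSeries.C d) hP (fun i ↦ hE3 i n)
  refine ⟨m, q, ?_⟩
  rw [SSFlatPackage.coe_map_neg_one]
  have eP : (-1 : IwasawaAlgebra p) * (toIwasawa p (sharpPoly ap p n) * (PowerSeries.C d * σ₀.1) +
      toIwasawa p (flatPoly ap p n) * (PowerSeries.C d * σ₀.2)) = PowerSeries.C d * P₀ := by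
    rw [hP₀]; ring
  rw [eP]
  exact e

/-- The Sprung pair of the family IS `(L♯, L♭)` and the ♭ Coleman value of `x_{δ₀}` is non-zero when `L♭ ≠ 0`.
[cite: Sprung2017, Thm. 1.12 (uniqueness)] [cite: Kato2004Asterisque, §13.9 (p. 230)] -/
theorem smul_generator_eq_and_flat_ne_zero {ap : ℤ} (hap : (p : ℤ) ∣ ap) {N : ℕ} {f : CuspForm (Gamma0 N) 2}
    {Lsharp Lflat : IwasawaAlgebra p} (hL : IsSprungPair f p ap Lsharp Lflat) (hLf : Lflat ≠ 0) {d : ℤ_[p]}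
    {σ₀ : IwasawaAlgebra p × IwasawaAlgebra p} (hσ : IsSprungPair f p ap (PowerSeries.C d * σ₀.1) (PowerSeries.C d * σ₀.2))
    {ι : Type*} {A : ι → IwasawaAlgebra p} {y : ι → IwasawaAlgebra p × IwasawaAlgebra p} (hy : ∀ i, A i • σ₀ = y i)
    {i₀ : ι} (hA0 : A i₀ ≠ 0) :
    (PowerSeries.C d * σ₀.1 = Lsharp ∧ PowerSeries.C d * σ₀.2 = Lflat) ∧ (y i₀).2 ≠ 0 := by
  obtain ⟨hs, hf⟩ := IsSprungPair.unique hap hσ hL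
  refine ⟨⟨hs, hf⟩, ?_⟩
  rw [← hy i₀, Prod.smul_snd, smul_eq_mul]
  refine mul_ne_zero hA0 fun h0 ↦ hLf ?_
  rw [← hf, h0, mul_zero]

end SprungPair

/-! ## §2 The assembly on the habitat (steps 4–6; `p = 2`) -/

section Habitat

variable (W : WeierstrassCurve ℚ) [W.IsElliptic] [W.IsGloballyMinimal] [ContinuousSMul ℤ_[2] (W.tateModule 2)]
  [Module.Free ℤ_[2] (W.tateModule 2)] [Module.Finite ℤ_[2] (W.tateModule 2)]
  {κ : ZpExtension ℚ 2} {γ : Field.absoluteGaloisGroup ℚ} (v : HeightOneSpectrum (𝓞 ℚ))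
  {g : Field.absoluteGaloisGroup (v.adicCompletion ℚ)} {c : ℕ → localPoints W (v.adicCompletion ℚ)}

/-- ★★★ **F3a ∧ F3b ∧ ZL2 OF CONJUNCT (8) FROM THE LEVELWISE CONGRUENCES OF A COPRIME FAMILY OF GENUINE CLASSES.**  Binders as in
(8) v2.19 (habitat `GoodSS W 2`, cyclotomic `(κ, γ)`, `v`, the local data `(g, c)` of a Honda system AT TWO for `ap` with `2 ∣ ap` — they enter only through the Coleman values `hJ` —, the pin `I`, any
`P`/`loc` with `(loc x : Λ) = (J (L x)).2`, `Lf`, `ϖ`); displayed: `hrank` (Kato 12.4 (2), `stub_pub`), `L` (`pairFun`, p830262) and `J` (Coleman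
map) `Λ`-linear with `hJ`, the Sprung pair `hL` with `Lf ≠ 0` (`SSFlatRoad.flat_ne_zero_two`), the family `(x_δ, A_δ)`, `d ≠ 0`, (H-LEV) =
tower-1's E3 VERBATIM (`μ := A δ`, `ν := C d`, `w := L (x δ)`), (COP) with genuineness, (h2), and `t = ϖ·d ∈ ℤ₂`.  Conclusion: LITERALLY
`∃ Z G, G ∈ Submodule.map (P.subtype ∘ₗ loc) Z ∧ iwasawaToPowerSeries 2 G = PowerSeries.C (ϖ : ℚ_[2]) * iwasawaToPowerSeries 2 Lf ∧ (∃ s₀, Z =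
Submodule.span Λ {s₀} ∧ ZL2)`. [cite: Kato2004Asterisque, Thm. 12.4 (2)(3) (p. 221), Thm. 12.5 (4), Thm. 12.6 (p. 222), §13.9, §13.12–13.14 (pp. 230–234)]
[cite: Sprung2012, Def. 7.1 (p. 1500), Thm. 7.14, 7.16] [cite: Sprung2017, Thm. 1.12, Cor. 4.4–4.5] -/
theorem flatF3_package_of_levelCongruences (hss : GoodSS W 2) (hκ : κ.IsCyclotomic) (hγ : κ.IsTopGenerator γ)
    (hg : κ.IsTopGenerator (resGalOfEmb (closureEmb (K := ℚ) (v.adicCompletion ℚ)) g)) {ap : ℤ} (hap : (2 : ℤ) ∣ ap)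
    (I : Kato2004.IwasawaH1Data W 2 κ γ) (hrank : Module.rank (IwasawaAlgebra 2) I.H ≤ 1)
    (L : letI := moduleOfGenerator κ (closureEmb (K := ℚ) (v.adicCompletion ℚ)) W hg
      I.H →ₗ[IwasawaAlgebra 2] (localTowerPointsOfEmb κ (closureEmb (K := ℚ) (v.adicCompletion ℚ)) W →+ ℤ_[2]))
    (J : letI := moduleOfGenerator κ (closureEmb (K := ℚ) (v.adicCompletion ℚ)) W hg
      (localTowerPointsOfEmb κ (closureEmb (K := ℚ) (v.adicCompletion ℚ)) W →+ ℤ_[2]) →ₗ[IwasawaAlgebra 2]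
        IwasawaAlgebra 2 × IwasawaAlgebra 2)
    (hJ : ∀ w, IsColemanPair κ (closureEmb (K := ℚ) (v.adicCompletion ℚ)) W ap g c w (J w).1 (J w).2)
    (P : Submodule (IwasawaAlgebra 2) (IwasawaAlgebra 2)) (loc : I.H →ₗ[IwasawaAlgebra 2] P)
    (hloc : ∀ x : I.H, (loc x : IwasawaAlgebra 2) = (J (L x)).2)
    {N : ℕ} (f : CuspForm (Gamma0 N) 2) (ϖ : ℚ) (Ls Lf : IwasawaAlgebra 2) (hL : IsSprungPair f 2 ap Ls Lf) (hLf : Lf ≠ 0)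
    {ι : Type*} (x : ι → I.H) (A : ι → IwasawaAlgebra 2) {d : ℤ_[2]} (hd : d ≠ 0)
    (hE3 : ∀ (i : ι) (n : ℕ), ∃ (m : ℕ) (q : IwasawaAlgebra 2), PowerSeries.C ((2 : ℚ_[2]) ^ m) *
        (iwasawaToPowerSeries 2 (A i) * (((mazurTateElement f 2 n).map (algebraMap ℚ ℚ_[2]) : ℚ_[2][X]) : PowerSeries ℚ_[2]) -
          iwasawaToPowerSeries 2 (PowerSeries.C d *
            pairingSum W (localTowerPointsOfEmb κ (closureEmb (K := ℚ) (v.adicCompletion ℚ)) W) g n (c n) (L (x i)))) =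
      iwasawaToPowerSeries 2 ((((cyclotomicOmega 2 n).map (Int.castRingHom ℤ_[2]) : ℤ_[2][X]) : PowerSeries ℤ_[2]) * q))
    (hcop : ∀ 𝔭 : PrimeSpectrum (IwasawaAlgebra 2), 𝔭.asIdeal.height = 1 →
      PowerSeries.C (2 : ℤ_[2]) ∉ 𝔭.asIdeal → ∃ i, A i ∉ 𝔭.asIdeal ∧
        Literature.NumberTheory.EllipticCurves.Kato2004.IsEulerSystemClassTwo W hκ I (x i) ∧ x i ≠ 0)
    (h2 : ∀ 𝔭 : PrimeSpectrum (IwasawaAlgebra 2), 𝔭.asIdeal.height = 1 →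
      PowerSeries.C (2 : ℤ_[2]) ∈ 𝔭.asIdeal → ∃ i, A i ∉ 𝔭.asIdeal)
    (t : ℤ_[2]) (ht : (t : ℚ_[2]) = (ϖ : ℚ_[2]) * (d : ℚ_[2])) :
    ∃ (Z : Submodule (IwasawaAlgebra 2) I.H) (G : IwasawaAlgebra 2),
      G ∈ Submodule.map (P.subtype ∘ₗ loc) Z ∧
      iwasawaToPowerSeries 2 G = PowerSeries.C (ϖ : ℚ_[2]) * iwasawaToPowerSeries 2 Lf ∧
      (∃ s₀ : I.H, Z = Submodule.span (IwasawaAlgebra 2) {s₀} ∧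
        ∀ 𝔭 : PrimeSpectrum (IwasawaAlgebra 2), 𝔭.asIdeal.height = 1 →
          PowerSeries.C (2 : ℤ_[2]) ∉ 𝔭.asIdeal →
          ∃ (M : IwasawaAlgebra 2) (s : I.H), M ∉ 𝔭.asIdeal ∧
            Literature.NumberTheory.EllipticCurves.Kato2004.IsEulerSystemClassTwo W hκ I s ∧ s ≠ 0 ∧
            M • s₀ = s) := by
  letI := moduleOfGenerator κ (closureEmb (K := ℚ) (v.adicCompletion ℚ)) W hg
  -- the coprimality clauses in the `(p : ℤ_[p])`-cast dialect of the generic files (`((2 : ℕ) : ℤ_[2]) = 2`)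
  have hcop' : ∀ 𝔭 : PrimeSpectrum (IwasawaAlgebra 2), 𝔭.asIdeal.height = 1 →
      PowerSeries.C ((2 : ℕ) : ℤ_[2]) ∉ 𝔭.asIdeal → ∃ i, A i ∉ 𝔭.asIdeal := fun 𝔭 h𝔭 hm ↦ by
    obtain ⟨i, hi, -, -⟩ := hcop 𝔭 h𝔭 (by simpa using hm)
    exact ⟨i, hi⟩
  have h2' : ∀ 𝔭 : PrimeSpectrum (IwasawaAlgebra 2), 𝔭.asIdeal.height = 1 →
      PowerSeries.C ((2 : ℕ) : ℤ_[2]) ∈ 𝔭.asIdeal → ∃ i, A i ∉ 𝔭.asIdeal := fun 𝔭 h𝔭 hm ↦ h2 𝔭 h𝔭 (by simpa using hm)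
  have hE3' : ∀ (i : ι) (n : ℕ), ∃ (m : ℕ) (q : IwasawaAlgebra 2), PowerSeries.C (((2 : ℕ) : ℚ_[2]) ^ m) *
        (iwasawaToPowerSeries 2 (A i) * (((mazurTateElement f 2 n).map (algebraMap ℚ ℚ_[2]) : ℚ_[2][X]) : PowerSeries ℚ_[2]) -
          iwasawaToPowerSeries 2 (PowerSeries.C d *
            pairingSum W (localTowerPointsOfEmb κ (closureEmb (K := ℚ) (v.adicCompletion ℚ)) W) g n (c n) (L (x i)))) =
      iwasawaToPowerSeries 2 ((((cyclotomicOmega 2 n).map (Int.castRingHom ℤ_[2]) : ℤ_[2][X]) : PowerSeries ℤ_[2]) * q) :=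
    fun i n ↦ by simpa only [Nat.cast_ofNat] using hE3 i n
  -- steps 1–3: the Sprung pair of the family, `= (L♯, L♭)`; a non-zero ♭ Coleman value
  obtain ⟨i₀, hA0⟩ := exists_ne_zero_of_coprime A hcop'
  obtain ⟨σ₀, hσ₀, hSP⟩ := exists_smul_eq_coleman_and_isSprungPair_of_family hg hap L J hJ x A hd hcop' h2' f hE3'
  obtain ⟨⟨-, hflat⟩, hnz⟩ := smul_generator_eq_and_flat_ne_zero hap hL hLf hSP hσ₀ hA0
  -- step 4: injectivity of `loc♭` on `𝐇¹` (rank ≤ 1) and proportionality in `𝐇¹`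
  obtain ⟨-, hinj⟩ := pairFun_injective_of_flat_ne_zero W κ v hγ hg I hrank L J (x i₀) hnz
  have hprop : ∀ i j, A j • x i = A i • x j := fun i j ↦
    smul_eq_smul_of_thetaCongruences hg hap L J hJ hinj
      (fun n ↦ (((mazurTateElement f 2 n).map (algebraMap ℚ ℚ_[2]) : ℚ_[2][X]) : PowerSeries ℚ_[2])) hd (hE3' i) (hE3' j)
  -- step 5: the generator `s₀ ∈ 𝐇¹` with the ZL2 clause; `J (L s₀) = σ₀`
  obtain ⟨s₀, hs₀, hZL⟩ := exists_zetaGenerator_zetaLineLocal_two W hss hκ hγ I x A i₀ hA0 hprop h2 hcop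
  have hJs₀ : J (L s₀) = σ₀ := by
    refine smul_cancel_of_ne_zero hA0 ?_
    rw [hσ₀ i₀, ← hs₀ i₀, map_smul, map_smul]
  have hCol : (PowerSeries.C d : IwasawaAlgebra 2) * (J (L s₀)).2 = Lf := by rw [hJs₀]; exact hflat
  -- step 6: the package
  exact flatF3_package_of_mul_coleman_eq W hκ v hg I L J P loc hloc Lf ϖ s₀ d hCol t ht hZL

end Habitat

end SSFlatPackage

end Summit.BirchSwinnertonDyer.BirchSwinnertonDyer.Theorems

end
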